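import Summits.ABC.IUTFork.Joshi.ArithmeticoidCollationPowers

/-!
# [J-II½] Prop. 7.5.1: what the two readings do to the VALUATION of a Kummer class — N preserves it (given the amphoricity of
# the valuation), W raises it to prime-to-`p` powers (proof-only companion; one reading-hypothesis, no new claim of print)

Proof-only file of the abc-iut cell, branch E (rung LADDER-ABC:A2.E; seat abc-iut-E-t38); no frozen import (E-PLAN R14). SOURCE and
locators as in `Joshi/ArithmeticoidCollation.lean` (K. Joshi, arXiv:2305.10398v12, UNREFEREED; bib `Joshi2023ATS2half`). **No side
is taken** on [IUTchIII] Cor. 3.12, on Joshi's claims, or on Mochizuki's report on them; typed ≠ proved; a located dichotomy is not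
a verdict on any author.

SETTING (carriers of `Joshi/ArithmeticoidCohomology.lean`; `𝔠 : CohomologyDatum`, standard arithmeticoid `y₀ = 𝔠.std`). By
[J-II½] Prop. 7.2.2 (2) the degree-one factor is `H^1(G_{L_v;K_v}, ℤ_{p_v}(1)) ≃ lim_n L_v^×/L_v^{×p_v^n}` (typed there as the claim
`NonarcKummer`); such a group carries the (completed) VALUATION of Kummer classes, typed here abstractly as homomorphisms
`ord v y : H 1 v y →* Λ v` into a value group `Λ v` (e.g. `ℤ_{p_v}` written multiplicatively). ONE READING-HYPOTHESIS, not a claim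
of [J-II½]: `CohPreservesOrd` — the isomorphisms induced by anabelomorphisms ([J-I] Thm. 8.4.1 (1), the datum `𝔠.coh`) preserve
`ord`. This is OUR READING, over the abstract carriers, of the amphoricity of the images `Im(𝒪^×_K) ⊂ Im(K^×)` under isomorphisms
of absolute Galois groups of MLFs ([AbsAnab] Prop. 1.2.1 (iii); in the tree:
`Literature.AnabelianGeometry.AbsoluteAnabelian.galoisMLF_iso_unitImage`, `…galoisMLF_iso_frobenius`) transported to Kummer
classes; it is NOT derived here from those Literature statements (that transport is the Kummer/LCFT dictionary, out of scope) and
NOT asserted. WHAT IS PROVED: (N) under `CohPreservesOrd`, every class in the N-collation (`collationProvided`, reading «provided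
by Prop. 7.4.1» = Galois-induced) has, factor by factor, the valuation of the source class it comes from
(`exists_source_ord_eq_of_mem_collationProvided`); (W) under reading W («all the isomorphisms (of topological groups) of each
factor»), with `y₀ ∈ A` and `c ∈ Ψ_{y₀}`, the W-collation contains `c^u` for every `u` with bijective power maps on the standard
factors (`Joshi/ArithmeticoidCollationPowers.lean`), and `ord (c^u) = (ord c)^u` (`pow_mem_collationAll_ord`). DICHOTOMY FOR D-10
(located, not adjudicated; consumers E-t18 `DictionaryCollation`, E-t22, E-cx): N-collation is valuation-PRESERVING (Ind1-shaped),
W-collation is valuation-RESCALING by prime-to-`p_v` units on Kummer classes — the precise place where «which isomorphisms Prop.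
7.4.1 provides» meets E-PLAN §2's load-bearing question «do the indeterminacies contain valuation-rescaling moves». Standard axioms
only; sorry-free. [claim: Joshi2023ATS2half, status: disputed]
-/

set_option autoImplicit false

noncomputable section

open Set

namespace Summit.ABC.IUTFork.Joshi.ATS2half

universe u

section Ord

variable {V : Type u} {Pt : V → Type u} {H : ℕ → (v : V) → Pt v → Type u} [∀ i v y, CommGroup (H i v y)]
  [∀ i v y, TopologicalSpace (H i v y)] {IsArc : Set V} {G : (v : V) → Pt v → Type u} [∀ v y, Group (G v y)]
  [∀ v y, TopologicalSpace (G v y)] {Λ : V → Type u} [∀ v, CommGroup (Λ v)]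

/-- **OUR READING-HYPOTHESIS (amphoricity of the valuation of Kummer classes)**: the isomorphisms `H^1(G_{L_v;K_a}, ·) ≃
H^1(G_{L_v;K_b}, ·)` induced by anabelomorphisms ([J-I] Thm. 8.4.1 (1), `𝔠.coh`) preserve the valuation homomorphisms `ord`. Over
the abstract carriers this is the Kummer-class form of [AbsAnab] Prop. 1.2.1 (iii) (tree: `galoisMLF_iso_unitImage`); stated as a
hypothesis, neither derived from the Literature statement nor asserted. [cite: MochizukiAbsAnab2004, Prop 1.2.1 (iii) p.10] -/
def CohomologyDatum.CohPreservesOrd (𝔠 : CohomologyDatum H IsArc G) (ord : ∀ (v : V) (y : Pt v), H 1 v y →* Λ v) : Prop :=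
  ∀ (v : V) (a b : Pt v) (α : G v a ≃ₜ* G v b) (x : H 1 v a), ord v b (𝔠.coh 1 v a b α x) = ord v a x

/-- An N-isomorphism (reading «provided by Prop. 7.4.1») preserves the valuation, under `CohPreservesOrd`. [folklore] -/
theorem CohomologyDatum.ord_eq_of_mem_providedIsos (𝔠 : CohomologyDatum H IsArc G) {ord : ∀ (v : V) (y : Pt v), H 1 v y →* Λ v}
    (h : 𝔠.CohPreservesOrd ord) {v : V} {a b : Pt v} {e : H 1 v a ≃ H 1 v b} (he : e ∈ 𝔠.providedIsos 1 v a b)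
    (x : H 1 v a) : ord v b (e x) = ord v a x := by
  obtain ⟨α, rfl⟩ := he
  exact h v a b α x

/-- **(N) The N-collation is valuation-preserving**: every class of `Ψ_{X,A}` in reading N comes from a source class `c ∈ Ψ_y`,
`y ∈ A`, with the SAME valuation at every place (given `CohPreservesOrd`). [folklore] -/
theorem CohomologyDatum.exists_source_ord_eq_of_mem_collationProvided (𝔠 : CohomologyDatum H IsArc G)
    {ord : ∀ (v : V) (y : Pt v), H 1 v y →* Λ v} (h : 𝔠.CohPreservesOrd ord) {A : Set (∀ v, Pt v)}
    {Ψ : ∀ y : (∀ v, Pt v), Set (CohArith H 1 y)} {c' : CohArith H 1 𝔠.std} (hc' : c' ∈ 𝔠.collationProvided 1 A Ψ) :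
    ∃ y ∈ A, ∃ c ∈ Ψ y, ∀ v, ord v (𝔠.std v) (c' v) = ord v (y v) (c v) := by
  obtain ⟨y, hy, c, hc, e, he, hc'e⟩ := hc'
  exact ⟨y, hy, c, hc, fun v => by rw [hc'e v]; exact 𝔠.ord_eq_of_mem_providedIsos h (he v) (c v)⟩

/-- In particular, collating in reading N the classes of the standard arithmeticoid ALONE (`A = {y₀}`) never changes a valuation
profile: every N-collated class has the valuation profile of some class of `Ψ_{y₀}`. [folklore] -/
theorem CohomologyDatum.exists_ord_eq_of_mem_collationProvided_std (𝔠 : CohomologyDatum H IsArc G)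
    {ord : ∀ (v : V) (y : Pt v), H 1 v y →* Λ v} (h : 𝔠.CohPreservesOrd ord) {Ψ : ∀ y : (∀ v, Pt v), Set (CohArith H 1 y)}
    {c' : CohArith H 1 𝔠.std} (hc' : c' ∈ 𝔠.collationProvided 1 {𝔠.std} Ψ) :
    ∃ c ∈ Ψ 𝔠.std, ∀ v, ord v (𝔠.std v) (c' v) = ord v (𝔠.std v) (c v) := by
  obtain ⟨y, hy, c, hc, hord⟩ := 𝔠.exists_source_ord_eq_of_mem_collationProvided h hc'
  rw [Set.mem_singleton_iff] at hy
  subst hy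
  exact ⟨c, hc, hord⟩

/-- **(W) The W-collation rescales valuations**: with `y₀ ∈ A` and `c ∈ Ψ_{y₀}`, for every exponent `u` whose power maps are
bijective on the (compact Hausdorff topological-monoid) standard factors, the class `c^u` is W-collated AND its valuation is the
`u`-th power (additively: `u` times) that of `c` at every place. [folklore] -/
theorem CohomologyDatum.pow_mem_collationAll_ord (𝔠 : CohomologyDatum H IsArc G)
    (ord : ∀ (v : V) (y : Pt v), H 1 v y →* Λ v) {A : Set (∀ v, Pt v)} {Ψ : ∀ y : (∀ v, Pt v), Set (CohArith H 1 y)}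
    (hstd : 𝔠.std ∈ A) {c : CohArith H 1 𝔠.std} (hc : c ∈ Ψ 𝔠.std) (u : ℕ) [∀ v, ContinuousMul (H 1 v (𝔠.std v))]
    [∀ v, CompactSpace (H 1 v (𝔠.std v))] [∀ v, T2Space (H 1 v (𝔠.std v))]
    (hu : ∀ v, Function.Bijective fun x : H 1 v (𝔠.std v) => x ^ u) :
    c ^ u ∈ 𝔠.collationAll 1 A Ψ ∧ ∀ v, ord v (𝔠.std v) ((c ^ u) v) = (ord v (𝔠.std v) (c v)) ^ u :=
  ⟨pow_mem_collationAll_const 𝔠 1 hstd hc u hu, fun v => by rw [Pi.pow_apply, map_pow]⟩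

/-- **The dichotomy in one line**: if some factor's valuation of `c` is not fixed by the `u`-th power (`(ord c_v)^u ≠ ord c_v`, e.g.
a uniformizer's class and `u ≠ 1` in a torsion-free value group), then the W-collated class `c^u` does NOT have the valuation profile
of `c` — whereas (N) every N-collated class has the valuation profile of its source. [folklore] -/
theorem CohomologyDatum.ord_pow_ne (𝔠 : CohomologyDatum H IsArc G) (ord : ∀ (v : V) (y : Pt v), H 1 v y →* Λ v)
    (c : CohArith H 1 𝔠.std) (u : ℕ) {v : V} (hne : (ord v (𝔠.std v) (c v)) ^ u ≠ ord v (𝔠.std v) (c v)) :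
    ord v (𝔠.std v) ((c ^ u) v) ≠ ord v (𝔠.std v) (c v) := by
  rwa [Pi.pow_apply, map_pow]

end Ord

end Summit.ABC.IUTFork.Joshi.ATS2half

end
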